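import Literature.Analysis.FluidPDE.CriticalSpacesProofs
import Literature.Analysis.FluidPDE.BesovMildBounds
import Literature.Analysis.FluidPDE.KochTataruLinear
import Literature.Analysis.FluidPDE.NSBoundedMildOseenIntegral
import Literature.Analysis.FunctionSpaces.LittlewoodPaleyConvergenceProofs
import Literature.Analysis.FunctionSpaces.LittlewoodPaleyBernsteinProofs
import Literature.Analysis.FunctionSpaces.SchwartzIntegrableTempered
import Literature.Analysis.FunctionSpaces.BMOInvLpProofs
import HarnessLib

/-!
# `Ḃ^{-1+3/p}_{p,∞}(ℝ³) ⊂ BMO⁻¹(ℝ³)`: proof of `Literature.Analysis.FluidPDE.memBMOInv_of_memHomBesov`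

Sibling proof file of `Literature/Analysis/FluidPDE/CriticalSpaces.lean` (the chain of critical
spaces, **ns.S16**). It **discharges the named fact**
`Literature.Analysis.FluidPDE.memBMOInv_of_memHomBesov`: if `U ∈ Ḃ^{-1+3/p}_{p,∞}(ℝ³)`, `1 ≤ p < ∞`,
is the tempered distribution of the vector field `u₀ : ℝ³ → ℝ³` (`IsDistributionOf u₀ U`), then
every component of `u₀` is in Koch–Tataru's space `BMO⁻¹` (divergence form,
`Literature.Analysis.FunctionSpaces.MemBMOInvVec`).

The source is Koch–Tataru, *Well-posedness for the Navier–Stokes equations*, Adv. Math. 157 (2001),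
§4 "Other function spaces", eq. (23) (p. 11–12 of the held copy `doi:10.1006/aima.2000.1937`):

> Let `p > n`. The tempered distribution `u` lies in `B^{-1+n/p}_{p,∞}` iff its caloric extension
> `v` satisfies `‖v(t)‖_{L^p} ≤ c t^{-(1-n/p)/2}` … Then
> `|B(x,R)|⁻¹ ∫_{Q(x,R)} |v|² ≤ |B(x,R)|^{-n/p} ∫₀^{R²} ‖v(t)‖²_{L^p} dt ≤ (p/n) |B(x,1)|^{-n/p} sup_t t^{1-n/p} ‖v(t)‖²_{L^p}`,
> hence `Lⁿ(ℝⁿ) ⊂ B^{-1+n/p}_{p,∞}(ℝⁿ) ⊂ BMO⁻¹` (23),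

combined with their Theorem 1 (`BMO⁻¹ = ∇ · (BMO)ⁿ`, the Carleson characterisation; in the tree
`Literature.Analysis.FunctionSpaces.memBMOInv_of_eCarlesonNorm_lt_top`, `BMOCarlesonPotential.lean`).
The case `p ≤ 3` of the vendored statement is reduced to `p > 3` by the Besov embedding
`Ḃ^{-1+3/p}_{p,∞} ⊂ Ḃ^{-1+3/r}_{r,∞}`, `p ≤ r` (Bahouri–Chemin–Danchin Prop. 2.20;
`Literature.Analysis.FunctionSpaces.MemHomBesov.of_exponent_le_holds`), exactly as announced in the
docstring of the fact.

## The proof (all steps proved here or in the tree)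

* `§ Tempered`: a field with a tempered distribution in the sense of `IsDistributionOf` is
  polynomially tempered, `(1 + ‖y‖²)^{-N} u₀ ∈ L¹` (`IsDistributionOf.isPolynomiallyTempered`; the
  uniform boundedness principle on `𝓢`, `SchwartzIntegrableTempered.lean`), which is the
  hypothesis "`u` is a tempered distribution" of Koch–Tataru's Theorem 1 in the tree's form.
* `§ HeatFlow`: **the heat flow of the distribution is the distribution of the caloric extension**,
  `IsDistributionOf (e^{tΔ}u₀) (e^{tΔ}U)` (`IsDistributionOf.heatExtension`: the Fourier multiplier
  `e^{tΔ}` acts on the test function, `⟨e^{tΔ}U, θ⟩ = ⟨U, G_t ∗ θ⟩`, and Fubini with Peetre's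
  inequality), so that finiteness of the distributional norm `‖e^{tΔ}U‖_{L^r}` makes `e^{tΔ}u₀` an
  `L^r` function with the same norm (`IsDistributionOf.memLp_of_eLpNormDistrib_lt_top`).
* `§ Carleson`: Koch–Tataru's computation: with `σ = 1 - d/r ∈ (0,1)` (`d < r < ∞`, `2 ≤ r`),
  `‖e^{tΔ}U‖_{L^r} ≤ C t^{-σ/2} ‖U‖_{Ḃ^{-σ}_{r,∞}}` (Bahouri–Chemin–Danchin Thm. 2.34, in the tree
  `Literature.Analysis.FunctionSpaces.exists_eLpNormDistrib_heatSemigroup_le_rpow_mul_eHomBesovNorm`),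
  Hölder on the ball `∫_{B(x,R)} |e^{tΔ}⟪u₀,v⟫|² ≤ ‖v‖² ‖e^{tΔ}U‖²_{L^r} |B(x,R)|^{1-2/r}` and
  `∫₀^{R²} t^{-σ} dt = (R²)^{d/r} r/d`, so that `R^{-d} ∫₀^{R²}∫_{B(x,R)} |e^{tΔ}⟪u₀,v⟫|²` is bounded
  uniformly in `x, R` (`eCarlesonNorm_inner_lt_top_of_memHomBesov`).
* `§ Discharge`: Koch–Tataru's Theorem 1 (`memBMOInv_of_eCarlesonNorm_lt_top`) for each component
  (`memBMOInvVec_of_memHomBesov_of_card_lt`, any dimension `d ≥ 1`), and the Besov embedding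
  `p ≤ r = max p 4` on `ℝ³` (`memBMOInv_of_memHomBesov_holds`).

No new definitions; no new named facts.

## References

* H. Koch, D. Tataru, *Well-posedness for the Navier–Stokes equations*, Adv. Math. 157 (2001),
  22–35, doi:10.1006/aima.2000.1937, §1 (3), Theorem 1, and §4 eq. (23). [KochTataru2001]
  (= [KochTataruAdvMath2001]; held: `paper:doi-10-1006-aima-2000-1937`, pp. 3, 11–12.)
* H. Bahouri, J.-Y. Chemin, R. Danchin, *Fourier Analysis and Nonlinear PDE* (2011), Prop. 2.20,
  Thm. 2.34. [BahouriCheminDanchin2011]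
-/

noncomputable section

open MeasureTheory Set Function Filter Metric TopologicalSpace SchwartzMap
open _root_.Topology _root_.Real
open scoped ENNReal NNReal RealInnerProductSpace SchwartzMap FourierTransform

namespace Literature.Analysis.FluidPDE

open UnboundedOperators (heatKernel heatExtension heatSymbol)
open FunctionSpaces (MemHomBesov eHomBesovNorm eLpNormDistrib lowFreqCutoff)
open FunctionSpaces.EuclideanSpace (complexify)

/-! ## Fields with a tempered distribution are polynomially tempered -/

section Tempered

variable {ι : Type*} [Fintype ι] {E : Type*} [NormedAddCommGroup E] [InnerProductSpace ℝ E]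
  [FiniteDimensional ℝ E] [MeasurableSpace E] [BorelSpace E]

/-- **A field with a tempered distribution is polynomially integrable**: if `θ • u₀ ∈ L¹` for every
Schwartz `θ` (the first half of `IsDistributionOf u₀ U`), then `(1 + ‖y‖²)^{-N} ‖u₀‖ ∈ L¹` for
some `N` (uniform boundedness principle on `𝓢(E, ℂ)`,
`Literature.Analysis.FunctionSpaces.exists_integrable_inv_one_add_norm_sq_pow_mul_norm`; this is
the hypothesis "`u` is a tempered distribution" of Koch–Tataru 2001, Theorem 1, in the tree's
form `htemp`). [cite: KochTataru2001, Theorem 1] -/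
theorem IsDistributionOf.exists_integrable_inv_one_add_norm_sq_pow_mul_norm
    {u₀ : E → EuclideanSpace ℝ ι} {U : 𝓢'(E, EuclideanSpace ℂ ι)} (hU : IsDistributionOf u₀ U) :
    ∃ N : ℕ, Integrable fun y : E => ((1 + ‖y‖ ^ 2) ^ N)⁻¹ * ‖u₀ y‖ := by
  obtain ⟨N, hN⟩ := FunctionSpaces.exists_integrable_inv_one_add_norm_sq_pow_mul_norm
    (w := fun x => complexify (u₀ x)) fun θ => (hU θ).1
  refine ⟨N, hN.congr (Eventually.of_forall fun y => ?_)⟩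
  simp only [FunctionSpaces.EuclideanSpace.norm_complexify]

/-- The Stein-growth form `(1 + ‖y‖)^{-K} ‖u₀‖ ∈ L¹` of the temperedness of a field with a tempered
distribution (Koch–Tataru 2001, Theorem 1). [cite: KochTataru2001, Theorem 1] -/
theorem IsDistributionOf.exists_integrable_inv_one_add_norm_pow_mul_norm
    {u₀ : E → EuclideanSpace ℝ ι} {U : 𝓢'(E, EuclideanSpace ℂ ι)} (hU : IsDistributionOf u₀ U) :
    ∃ K : ℕ, Integrable fun y : E => ((1 + ‖y‖) ^ K)⁻¹ * ‖u₀ y‖ := by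
  obtain ⟨N, hN⟩ := hU.exists_integrable_inv_one_add_norm_sq_pow_mul_norm
  exact ⟨2 * N, FunctionSpaces.BMOInv.integrable_growth_of_tempered hN⟩

/-- **A field on `ℝ^ι` with a tempered distribution is polynomially tempered** in the sense of
`IsPolynomiallyTempered` (`(1 + ‖y‖²)^{-N} • u₀ ∈ L¹`; Koch–Tataru 2001, Theorem 1, "tempered
distribution `u`"). [cite: KochTataru2001, Theorem 1] -/
theorem IsDistributionOf.isPolynomiallyTempered {u₀ : EuclideanSpace ℝ ι → EuclideanSpace ℝ ι}
    {U : 𝓢'(EuclideanSpace ℝ ι, EuclideanSpace ℂ ι)} (hU : IsDistributionOf u₀ U) :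
    IsPolynomiallyTempered u₀ := by
  obtain ⟨N, hN⟩ := hU.exists_integrable_inv_one_add_norm_sq_pow_mul_norm
  have hc : Continuous fun y : EuclideanSpace ℝ ι => ((1 + ‖y‖ ^ 2) ^ N : ℝ)⁻¹ :=
    Continuous.inv₀ (by fun_prop) fun y => by positivity
  refine ⟨N, hN.mono' (hc.aestronglyMeasurable.smul hU.aestronglyMeasurable)
    (Eventually.of_forall fun y => ?_)⟩
  rw [norm_smul, Real.norm_of_nonneg (by positivity)]

end Tempered

/-! ## The heat flow of a field with a tempered distribution -/

section HeatFlow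

variable {ι : Type*} [Fintype ι] {E : Type*} [NormedAddCommGroup E] [InnerProductSpace ℝ E]
  [FiniteDimensional ℝ E] [MeasurableSpace E] [BorelSpace E]

/-- **The heat flow of the distribution of a tempered field is the distribution of its caloric
extension**: if `U` is the distribution of `u₀` (with `(1 + ‖y‖)^{-K} ‖u₀‖ ∈ L¹`) and `t > 0`, then
`e^{tΔ}U` (the Fourier multiplier `Literature`'s `TemperedDistribution.heatSemigroup`) is the
distribution of `e^{tΔ}u₀ = G_t ∗ u₀` (`Literature.Analysis.UnboundedOperators.heatExtension`):
`⟨e^{tΔ}U, θ⟩ = ⟨U, G_t ∗ θ⟩ = ∫∫ θ(x) G_t(x - y) u₀(y) = ∫ θ · (G_t ∗ u₀)`, the Fubini step being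
justified by Peetre's inequality `(1+‖y‖)^K ≤ (1+‖x‖)^K (1+‖x-y‖)^K`, the Gaussian moments
`sup (1+‖z‖)^K G_t(z) < ∞` and the Schwartz decay of `θ` (Koch–Tataru 2001, §1 (2): the caloric
extension of a tempered distribution; Stein–Weiss, Ch. I, Thm. 1.18). [cite: KochTataru2001, §1 (2)] -/
theorem IsDistributionOf.heatExtension {u₀ : E → EuclideanSpace ℝ ι} {U : 𝓢'(E, EuclideanSpace ℂ ι)}
    (hU : IsDistributionOf u₀ U) {K : ℕ} (hK : Integrable fun y : E => ((1 + ‖y‖) ^ K)⁻¹ * ‖u₀ y‖)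
    {t : ℝ} (ht : 0 < t) :
    IsDistributionOf (UnboundedOperators.heatExtension u₀ t) (TemperedDistribution.heatSemigroup t U) := by
  intro θ
  set d : ℕ := Module.finrank ℝ E with hd
  have hmeas : AEStronglyMeasurable u₀ volume := hU.aestronglyMeasurable
  have hcf : AEStronglyMeasurable (fun y => complexify (u₀ y)) volume :=
    FunctionSpaces.EuclideanSpace.continuous_complexify.comp_aestronglyMeasurable hmeas
  have hGpos : ∀ z : E, 0 ≤ heatKernel t z := fun z => (UnboundedOperators.heatKernel_pos ht z).le
  have hGc : Continuous (heatKernel (E := E) t) := UnboundedOperators.continuous_heatKernel t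
  -- Schwartz decay of `θ`: `(1 + ‖x‖)^(K + d + 1) ‖θ x‖ ≤ Cθ`
  obtain ⟨Cθ, hCθ0, hθb⟩ : ∃ Cθ : ℝ, 0 ≤ Cθ ∧ ∀ x : E, (1 + ‖x‖) ^ (K + (d + 1)) * ‖θ x‖ ≤ Cθ := by
    refine ⟨2 ^ (K + (d + 1)) *
      (Finset.Iic (K + (d + 1), 0)).sup (fun m => SchwartzMap.seminorm ℂ m.1 m.2) θ,
      mul_nonneg (pow_nonneg two_pos.le _) (apply_nonneg _ _), fun x => ?_⟩
    have h := SchwartzMap.one_add_le_sup_seminorm_apply (𝕜 := ℂ) (m := (K + (d + 1), 0))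
      (k := K + (d + 1)) (n := 0) le_rfl le_rfl θ x
    simpa only [norm_iteratedFDeriv_zero] using h
  -- Gaussian moments: `(1 + ‖z‖)^K G_t(z) ≤ CK`
  obtain ⟨CK, hCK⟩ := FunctionSpaces.BMOInv.exists_bound_one_add_norm_pow_mul_heatKernel ht (0 : E) K
  have hCK' : ∀ z : E, (1 + ‖z‖) ^ K * heatKernel t z ≤ CK := fun z => by
    have h := hCK (-z)
    rwa [norm_neg, zero_sub, neg_neg] at h
  -- the integrand on `E × E` and its domination
  set H : E → E → EuclideanSpace ℂ ι := fun x y =>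
    (θ x * (heatKernel t (x - y) : ℂ)) • complexify (u₀ y) with hH
  have hHnorm : ∀ x y, ‖H x y‖ = ‖θ x‖ * heatKernel t (x - y) * ‖u₀ y‖ := fun x y => by
    simp only [hH, norm_smul, norm_mul, Complex.norm_real, Real.norm_of_nonneg (hGpos _),
      FunctionSpaces.EuclideanSpace.norm_complexify]
  have hdom : ∀ x y, ‖H x y‖ ≤ (Cθ * CK * ((1 + ‖x‖) ^ (d + 1))⁻¹) *
      (((1 + ‖y‖) ^ K)⁻¹ * ‖u₀ y‖) := by
    intro x y
    rw [hHnorm]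
    have hA : (0 : ℝ) < (1 + ‖x‖) ^ (d + 1) := by positivity
    have hB : (0 : ℝ) < (1 + ‖y‖) ^ K := by positivity
    -- Peetre: `(1+‖y‖)^K ≤ (1+‖x‖)^K (1+‖x-y‖)^K`
    have hP := FunctionSpaces.BMOInv.one_add_norm_pow_le_mul_pow x y K
    have hkey : ‖θ x‖ * heatKernel t (x - y) * (1 + ‖x‖) ^ (d + 1) * (1 + ‖y‖) ^ K ≤ Cθ * CK := by
      calc ‖θ x‖ * heatKernel t (x - y) * (1 + ‖x‖) ^ (d + 1) * (1 + ‖y‖) ^ K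
          ≤ ‖θ x‖ * heatKernel t (x - y) * (1 + ‖x‖) ^ (d + 1) *
              ((1 + ‖x‖) ^ K * (1 + ‖x - y‖) ^ K) :=
            mul_le_mul_of_nonneg_left hP
              (mul_nonneg (mul_nonneg (norm_nonneg _) (hGpos _)) (by positivity))
        _ = ((1 + ‖x‖) ^ (K + (d + 1)) * ‖θ x‖) * ((1 + ‖x - y‖) ^ K * heatKernel t (x - y)) := by
            ring
        _ ≤ Cθ * CK :=
            mul_le_mul (hθb x) (hCK' (x - y)) (mul_nonneg (by positivity) (hGpos _)) hCθ0
    calc ‖θ x‖ * heatKernel t (x - y) * ‖u₀ y‖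
        = (‖θ x‖ * heatKernel t (x - y) * (1 + ‖x‖) ^ (d + 1) * (1 + ‖y‖) ^ K) *
            (((1 + ‖x‖) ^ (d + 1))⁻¹ * (((1 + ‖y‖) ^ K)⁻¹ * ‖u₀ y‖)) := by
          field_simp
      _ ≤ (Cθ * CK) * (((1 + ‖x‖) ^ (d + 1))⁻¹ * (((1 + ‖y‖) ^ K)⁻¹ * ‖u₀ y‖)) :=
          mul_le_mul_of_nonneg_right hkey (by positivity)
      _ = _ := by ring
  -- measurability and integrability on the product
  have hHm : AEStronglyMeasurable (uncurry H) ((volume : Measure E).prod volume) := by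
    have h1 : Continuous fun z : E × E => θ z.1 * (heatKernel t (z.1 - z.2) : ℂ) :=
      (θ.continuous.comp continuous_fst).mul
        (Complex.continuous_ofReal.comp (hGc.comp (continuous_fst.sub continuous_snd)))
    exact h1.aestronglyMeasurable.smul hcf.comp_snd
  have hHint : Integrable (uncurry H) ((volume : Measure E).prod volume) := by
    have hw : Integrable (fun x : E => Cθ * CK * ((1 + ‖x‖) ^ (d + 1))⁻¹) :=
      (FunctionSpaces.BMOInv.integrable_inv_one_add_norm_pow (E := E)).const_mul _
    refine (hw.mul_prod hK).mono' hHm (Eventually.of_forall fun z => ?_)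
    exact hdom z.1 z.2
  -- left slices: `θ x • complexify (e^{tΔ}u₀ (x)) = ∫_y H x y`
  have hL : ∀ x, θ x • complexify (UnboundedOperators.heatExtension u₀ t x) = ∫ y, H x y := by
    intro x
    rw [UnboundedOperators.heatExtension_eq_integral_sub, ← (complexify (ι := ι)).integral_comp_comm,
      ← integral_smul]
    refine integral_congr_ae (Eventually.of_forall fun y => ?_)
    simp only [hH, LinearIsometry.map_smul, mul_smul, Complex.coe_smul]
  -- right slices: `(G_t ∗ θ)(y) • complexify (u₀ y) = ∫_x H x y`
  set ψ : 𝓢(E, ℂ) := 𝓕 (SchwartzMap.smulLeftCLM ℂ (fun ξ : E => (heatSymbol t ξ : ℂ)) (𝓕⁻ θ)) with hψ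
  have hR : ∀ y, ψ y • complexify (u₀ y) = ∫ x, H x y := by
    intro y
    rw [hψ, fourier_smulLeftCLM_heatSymbol_fourierInv_apply ht θ y, ← integral_smul_const]
    refine integral_congr_ae (Eventually.of_forall fun x => ?_)
    simp only [hH, ← UnboundedOperators.heatKernel_neg t (x - y), neg_sub]
  refine ⟨?_, ?_⟩
  · -- integrability of `θ • complexify (e^{tΔ}u₀)`
    refine hHint.integral_prod_left.congr (Eventually.of_forall fun x => ?_)
    exact (hL x).symm
  · -- the identity `⟨e^{tΔ}U, θ⟩ = ∫ θ • complexify (e^{tΔ}u₀)`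
    show U ψ = ∫ x, θ x • complexify (UnboundedOperators.heatExtension u₀ t x)
    rw [(hU ψ).2]
    calc ∫ y, ψ y • complexify (u₀ y) = ∫ y, ∫ x, H x y :=
          integral_congr_ae (Eventually.of_forall hR)
      _ = ∫ x, ∫ y, H x y := (integral_integral_swap hHint).symm
      _ = ∫ x, θ x • complexify (UnboundedOperators.heatExtension u₀ t x) :=
          integral_congr_ae (Eventually.of_forall fun x => (hL x).symm)

/-- **An `L^q` distribution of a field makes the field `L^q`**: if `W` is the distribution of the
field `w` and `‖W‖_{L^q} < ∞` (the distributional norm `eLpNormDistrib`, i.e. `W` is the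
distribution of some `f ∈ L^q(E; ℂ^ι)`), then `w ∈ L^q` with `‖w‖_{L^q} = ‖W‖_{L^q}`: both
`complexify ∘ w` and `f` integrate real test functions in the same way, hence agree a.e. (Mathlib's
`ae_eq_of_integral_contDiff_smul_eq`; BCD §1.1, `L^p ⊂ 𝓢'` is injective). [folklore] -/
theorem IsDistributionOf.memLp_of_eLpNormDistrib_lt_top {w : E → EuclideanSpace ℝ ι}
    {W : 𝓢'(E, EuclideanSpace ℂ ι)} (hW : IsDistributionOf w W) {q : ℝ≥0∞} [Fact (1 ≤ q)]
    (h : eLpNormDistrib q W < ∞) :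
    MemLp w q volume ∧ eLpNorm w q volume = eLpNormDistrib q W := by
  obtain ⟨f, hf⟩ := FunctionSpaces.exists_coe_eq_of_eLpNormDistrib_lt_top h
  have hloc_w : LocallyIntegrable (fun x => complexify (w x)) volume :=
    hW.locallyIntegrable.mono
      (FunctionSpaces.EuclideanSpace.continuous_complexify.comp_aestronglyMeasurable hW.aestronglyMeasurable)
      (Eventually.of_forall fun x => (FunctionSpaces.EuclideanSpace.norm_complexify (w x)).le)
  have hloc_f : LocallyIntegrable (f : E → EuclideanSpace ℂ ι) volume :=
    (Lp.memLp f).locallyIntegrable Fact.out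
  -- `complexify ∘ w = f` a.e.
  have hae : (fun x => complexify (w x)) =ᵐ[volume] (f : E → EuclideanSpace ℂ ι) := by
    refine ae_eq_of_integral_contDiff_smul_eq hloc_w hloc_f fun g hg hgs => ?_
    have hcs : HasCompactSupport fun y => ((g y : ℝ) : ℂ) := hgs.comp_left Complex.ofReal_zero
    have hcd : ContDiff ℝ ((⊤ : ℕ∞) : WithTop ℕ∞) fun y => ((g y : ℝ) : ℂ) :=
      Complex.ofRealCLM.contDiff.comp hg
    set θ : 𝓢(E, ℂ) := hcs.toSchwartzMap hcd with hθ
    have hθ_apply : ∀ y, θ y = ((g y : ℝ) : ℂ) := fun y => rfl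
    have h1 : W θ = ∫ y, g y • complexify (w y) := by
      rw [(hW θ).2]
      refine integral_congr_ae (Eventually.of_forall fun y => ?_)
      simp only [hθ_apply, Complex.coe_smul]
    have h2 : W θ = ∫ y, g y • (f : E → EuclideanSpace ℂ ι) y := by
      rw [← hf, Lp.toTemperedDistribution_apply]
      refine integral_congr_ae (Eventually.of_forall fun y => ?_)
      simp only [hθ_apply, Complex.coe_smul]
    rw [← h1, h2]
  have hmem : MemLp (fun x => complexify (w x)) q volume := (Lp.memLp f).ae_eq hae.symm
  refine ⟨memLp_complexify_comp_iff.1 hmem, ?_⟩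
  rw [← hf, FunctionSpaces.eLpNormDistrib_coe, Lp.enorm_def, ← eLpNorm_congr_ae hae]
  exact (eLpNorm_congr_norm_ae (Eventually.of_forall fun x =>
    FunctionSpaces.EuclideanSpace.norm_complexify (w x))).symm

/-- Components of the caloric extension in `L^q`: for a polynomially tempered field `u₀ : E → E`,
`‖e^{tΔ}⟪u₀, v⟫‖_{L^q} ≤ ‖v‖ ‖e^{tΔ}u₀‖_{L^q}` (`⟪e^{tΔ}u₀, v⟫ = e^{tΔ}⟪u₀, v⟫`,
`Literature.Analysis.FluidPDE.inner_heatExtension_eq_heatExtension_inner`, and Cauchy–Schwarz).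
[folklore] -/
theorem eLpNorm_heatExtension_inner_le {u₀ : E → E} (h : IsPolynomiallyTempered u₀) {t : ℝ}
    (ht : 0 < t) (v : E) (q : ℝ≥0∞) :
    eLpNorm (FunctionSpaces.BMOInv.heatExtension (fun z => ⟪u₀ z, v⟫) t) q volume ≤
      ENNReal.ofReal ‖v‖ * eLpNorm (heatExtension u₀ t) q volume := by
  refine eLpNorm_le_mul_eLpNorm_of_ae_le_mul (Eventually.of_forall fun y => ?_) q
  rw [← inner_heatExtension_eq_heatExtension_inner h ht y v, Real.norm_eq_abs, mul_comm]
  exact abs_real_inner_le_norm _ _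

end HeatFlow

/-! ## Koch–Tataru's Carleson bound for Besov data -/

section Carleson

variable {ι : Type*} [Fintype ι]

/-- `∫₀^{a} t^{e} dt = a^{e+1}/(e+1)` as a lower Lebesgue integral, for `-1 < e` and `0 < a`.
[folklore] -/
theorem lintegral_Ioo_rpow_eq {e a : ℝ} (he : -1 < e) (ha : 0 < a) :
    ∫⁻ t in Ioo 0 a, ENNReal.ofReal (t ^ e) = ENNReal.ofReal (a ^ (e + 1) / (e + 1)) := by
  have hii : IntervalIntegrable (fun t : ℝ => t ^ e) volume 0 a :=
    intervalIntegral.intervalIntegrable_rpow' he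
  have hint : IntegrableOn (fun t : ℝ => t ^ e) (Ioo 0 a) := (hii.1).mono_set Ioo_subset_Ioc_self
  have hnn : 0 ≤ᵐ[volume.restrict (Ioo 0 a)] fun t : ℝ => t ^ e :=
    (ae_restrict_mem measurableSet_Ioo).mono fun t ht => Real.rpow_nonneg ht.1.le _
  rw [← ofReal_integral_eq_lintegral_ofReal hint hnn, ← integral_Ioc_eq_integral_Ioo,
    ← intervalIntegral.integral_of_le ha.le, integral_rpow (Or.inl he)]
  congr 1
  rw [Real.zero_rpow (by linarith), sub_zero]

/-- **Hölder on the ball** (Koch–Tataru 2001, proof of (23), `|B|⁻¹∫_B |v|² ≤ |B|^{-2/p}‖v‖²_{L^p}`):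
for `2 ≤ r` and a measurable `g`, `∫_{B(x,R)} |g|² ≤ ‖g‖²_{L^r} |B(x,R)|^{1-2/r}`
(`MeasureTheory.eLpNorm_le_eLpNorm_mul_rpow_measure_univ` on the restricted measure).
[cite: KochTataru2001, §4 eq. (23)] -/
theorem lintegral_ball_enorm_sq_le_eLpNorm_sq_mul {E : Type*} [NormedAddCommGroup E]
    [MeasurableSpace E] {μ : Measure E} {g : E → ℝ} (hg : AEStronglyMeasurable g μ) {r : ℝ≥0∞}
    (h2r : 2 ≤ r) (x : E) (R : ℝ) :
    ∫⁻ y in ball x R, ‖g y‖ₑ ^ 2 ∂μ ≤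
      eLpNorm g r μ ^ 2 * μ (ball x R) ^ (1 - 2 / r.toReal) := by
  have h := eLpNorm_le_eLpNorm_mul_rpow_measure_univ (μ := μ.restrict (ball x R)) h2r hg.restrict
  rw [Measure.restrict_apply_univ, ENNReal.toReal_ofNat] at h
  rw [← eLpNorm_two_sq_eq_lintegral]
  calc eLpNorm g 2 (μ.restrict (ball x R)) ^ 2
      ≤ (eLpNorm g r (μ.restrict (ball x R)) * μ (ball x R) ^ (1 / 2 - 1 / r.toReal)) ^ 2 := by
        gcongr
    _ = eLpNorm g r (μ.restrict (ball x R)) ^ 2 * (μ (ball x R) ^ (1 / 2 - 1 / r.toReal)) ^ 2 := by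
        ring
    _ ≤ eLpNorm g r μ ^ 2 * (μ (ball x R) ^ (1 / 2 - 1 / r.toReal)) ^ 2 := by
        gcongr
        exact Measure.restrict_le_self
    _ = eLpNorm g r μ ^ 2 * μ (ball x R) ^ (1 - 2 / r.toReal) := by
        rw [← ENNReal.rpow_natCast (μ (ball x R) ^ (1 / 2 - 1 / r.toReal)) 2, ← ENNReal.rpow_mul]
        congr 2
        push_cast
        ring

variable [Nonempty ι]

/-- **Koch–Tataru's Carleson bound for Besov data** (Koch–Tataru 2001, §4, proof of eq. (23)):
let `d = card ι ≥ 1`, `2 ≤ r`, `d < r < ∞`, `σ = 1 - d/r`, and let `U ∈ Ḃ^{-1+d/r}_{r,∞}` be the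
tempered distribution of the field `u₀ : ℝ^ι → ℝ^ι`. Then for every direction `v`, Koch–Tataru's
quantity `sup_{x,R} R^{-d} ∫₀^{R²}∫_{B(x,R)} |e^{tΔ}⟪u₀, v⟫|² dy dt` is finite: with
`‖e^{tΔ}U‖_{L^r} ≤ C t^{-σ/2} ‖U‖_{Ḃ^{-σ}_{r,∞}}` (BCD Thm. 2.34, the tree's
`exists_eLpNormDistrib_heatSemigroup_le_rpow_mul_eHomBesovNorm`) and Hölder on the ball,
`∫₀^{R²}∫_{B(x,R)} |e^{tΔ}⟪u₀,v⟫|² ≤ ‖v‖² C² ‖U‖² |B(x,R)|^{1-2/r} ∫₀^{R²} t^{-σ} dt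
 = ‖v‖² C² ‖U‖² |B(0,1)|^{1-2/r} R^{d(1-2/r)} (R²)^{d/r} (r/d) = const · R^d`.
[cite: KochTataru2001, §4 eq. (23)] -/
theorem eCarlesonNorm_inner_lt_top_of_memHomBesov {r : ℝ≥0∞} [Fact (1 ≤ r)] (h2r : 2 ≤ r)
    (hdr : (Fintype.card ι : ℝ) < r.toReal) {u₀ : EuclideanSpace ℝ ι → EuclideanSpace ℝ ι}
    {U : 𝓢'(EuclideanSpace ℝ ι, EuclideanSpace ℂ ι)}
    (hU : IsDistributionOf u₀ U)
    (hB : MemHomBesov (-1 + (Fintype.card ι : ℝ) / r.toReal) r ∞ U) (v : EuclideanSpace ℝ ι) :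
    FunctionSpaces.BMOInv.eCarlesonNorm (fun z => ⟪u₀ z, v⟫) < ∞ := by
  -- the parameters
  set d : ℕ := Fintype.card ι with hd
  have hd0 : 0 < d := Fintype.card_pos
  have hdpos : (0 : ℝ) < d := by exact_mod_cast hd0
  have hrpos : 0 < r.toReal := hdpos.trans hdr
  have hr_top : r ≠ ∞ := fun h => by simp [h] at hrpos
  have hfin : Module.finrank ℝ (EuclideanSpace ℝ ι) = d := finrank_euclideanSpace
  set σ : ℝ := 1 - d / r.toReal with hσ
  have hσ0 : 0 < σ := by
    rw [hσ, sub_pos, div_lt_one hrpos]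
    exact hdr
  have hσ1 : σ < 1 := by
    rw [hσ, sub_lt_self_iff]
    exact div_pos hdpos hrpos
  have h2r' : (2 : ℝ) ≤ r.toReal := by
    have := ENNReal.toReal_mono hr_top h2r
    rwa [ENNReal.toReal_ofNat] at this
  have hexp0 : 0 ≤ 1 - 2 / r.toReal := by
    rw [sub_nonneg, div_le_one hrpos]
    exact h2r'
  -- temperedness of `u₀`
  have htemp : IsPolynomiallyTempered u₀ := hU.isPolynomiallyTempered
  obtain ⟨K, hK⟩ := hU.exists_integrable_inv_one_add_norm_pow_mul_norm
  have humeas : AEStronglyMeasurable (fun z => ⟪u₀ z, v⟫) volume :=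
    hU.aestronglyMeasurable.inner_const
  -- the Besov heat estimate
  obtain ⟨C, hC⟩ := FunctionSpaces.exists_eLpNormDistrib_heatSemigroup_le_rpow_mul_eHomBesovNorm
    (E := EuclideanSpace ℝ ι) (F := EuclideanSpace ℂ ι) r (σ := σ) hσ0
  have hnegσ : -σ = -1 + (d : ℝ) / r.toReal := by rw [hσ]; ring
  have hBσ : MemHomBesov (-σ) r ∞ U := by rw [hnegσ]; exact hB
  set N : ℝ≥0∞ := eHomBesovNorm (-σ) r ∞ U with hN
  have hNtop : N < ∞ := hBσ.1
  -- `L^r` bound of the scalar caloric extension, `t > 0`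
  have hLr : ∀ t : ℝ, 0 < t →
      eLpNorm (FunctionSpaces.BMOInv.heatExtension (fun z => ⟪u₀ z, v⟫) t) r volume ≤
        ENNReal.ofReal ‖v‖ * (C * ENNReal.ofReal (t ^ (-σ / 2)) * N) := by
    intro t ht
    have hdist := hU.heatExtension hK ht
    have hle : eLpNormDistrib r (TemperedDistribution.heatSemigroup t U) ≤
        C * ENNReal.ofReal (t ^ (-σ / 2)) * N := hC t ht U hBσ.2
    have hlt : eLpNormDistrib r (TemperedDistribution.heatSemigroup t U) < ∞ :=
      hle.trans_lt (ENNReal.mul_lt_top (ENNReal.mul_lt_top ENNReal.coe_lt_top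
        ENNReal.ofReal_lt_top) hNtop)
    obtain ⟨-, heq⟩ := hdist.memLp_of_eLpNormDistrib_lt_top hlt
    calc eLpNorm (FunctionSpaces.BMOInv.heatExtension (fun z => ⟪u₀ z, v⟫) t) r volume
        ≤ ENNReal.ofReal ‖v‖ * eLpNorm (heatExtension u₀ t) r volume :=
          eLpNorm_heatExtension_inner_le htemp ht v r
      _ ≤ ENNReal.ofReal ‖v‖ * (C * ENNReal.ofReal (t ^ (-σ / 2)) * N) := by
          rw [heq]
          gcongr
  -- the constant
  set A : ℝ≥0∞ := (ENNReal.ofReal ‖v‖ * (C * N)) ^ 2 *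
    volume (ball (0 : EuclideanSpace ℝ ι) 1) ^ (1 - 2 / r.toReal) * ENNReal.ofReal (1 / (1 - σ)) with hA
  have hAtop : A < ∞ := by
    refine ENNReal.mul_lt_top (ENNReal.mul_lt_top (ENNReal.pow_lt_top (ENNReal.mul_lt_top
      ENNReal.ofReal_lt_top (ENNReal.mul_lt_top ENNReal.coe_lt_top hNtop))) ?_) ENNReal.ofReal_lt_top
    exact ENNReal.rpow_lt_top_of_nonneg hexp0 measure_ball_lt_top.ne
  refine lt_of_le_of_lt (iSup_le fun x => iSup₂_le fun R hR => ?_) hAtop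
  -- the box estimate for the ball `B(x, R)`
  have hRd : (0 : ℝ) < R ^ d := pow_pos hR d
  have hvol : volume (ball x R) = ENNReal.ofReal (R ^ d) * volume (ball (0 : EuclideanSpace ℝ ι) 1) := by
    rw [Measure.addHaar_ball_of_pos volume x hR, hfin]
  have hbox : ∀ t ∈ Ioo (0 : ℝ) (R ^ 2),
      ∫⁻ y in ball x R, ‖FunctionSpaces.BMOInv.heatExtension (fun z => ⟪u₀ z, v⟫) t y‖ₑ ^ 2 ≤
        ((ENNReal.ofReal ‖v‖ * (C * N)) ^ 2 * volume (ball x R) ^ (1 - 2 / r.toReal)) *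
          ENNReal.ofReal (t ^ (-σ)) := by
    intro t ht
    have hgm : AEStronglyMeasurable
        (FunctionSpaces.BMOInv.heatExtension (fun z => ⟪u₀ z, v⟫) t) volume :=
      (FunctionSpaces.BMOInv.measurable_heatExtension_section humeas t).aestronglyMeasurable
    have hsq : ENNReal.ofReal (t ^ (-σ / 2)) ^ 2 = ENNReal.ofReal (t ^ (-σ)) := by
      rw [← ENNReal.ofReal_pow (Real.rpow_nonneg ht.1.le _), ← Real.rpow_natCast,
        ← Real.rpow_mul ht.1.le]
      norm_num
    calc ∫⁻ y in ball x R, ‖FunctionSpaces.BMOInv.heatExtension (fun z => ⟪u₀ z, v⟫) t y‖ₑ ^ 2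
        ≤ eLpNorm (FunctionSpaces.BMOInv.heatExtension (fun z => ⟪u₀ z, v⟫) t) r volume ^ 2 *
            volume (ball x R) ^ (1 - 2 / r.toReal) :=
          lintegral_ball_enorm_sq_le_eLpNorm_sq_mul hgm h2r x R
      _ ≤ (ENNReal.ofReal ‖v‖ * (C * ENNReal.ofReal (t ^ (-σ / 2)) * N)) ^ 2 *
            volume (ball x R) ^ (1 - 2 / r.toReal) := by
          gcongr
          exact hLr t ht.1
      _ = ((ENNReal.ofReal ‖v‖ * (C * N)) ^ 2 * volume (ball x R) ^ (1 - 2 / r.toReal)) *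
            ENNReal.ofReal (t ^ (-σ)) := by
          rw [← hsq]
          ring
  -- the time integration
  have htime : ∫⁻ t in Ioo (0 : ℝ) (R ^ 2), ENNReal.ofReal (t ^ (-σ)) =
      ENNReal.ofReal ((R ^ 2) ^ (-σ + 1) / (-σ + 1)) :=
    lintegral_Ioo_rpow_eq (by linarith) (by positivity)
  have hI : ∫⁻ t in Ioo (0 : ℝ) (R ^ 2), ∫⁻ y in ball x R,
      ‖FunctionSpaces.BMOInv.heatExtension (fun z => ⟪u₀ z, v⟫) t y‖ₑ ^ 2 ≤
      ((ENNReal.ofReal ‖v‖ * (C * N)) ^ 2 * volume (ball x R) ^ (1 - 2 / r.toReal)) *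
        ENNReal.ofReal ((R ^ 2) ^ (-σ + 1) / (-σ + 1)) := by
    calc ∫⁻ t in Ioo (0 : ℝ) (R ^ 2), ∫⁻ y in ball x R,
          ‖FunctionSpaces.BMOInv.heatExtension (fun z => ⟪u₀ z, v⟫) t y‖ₑ ^ 2
        ≤ ∫⁻ t in Ioo (0 : ℝ) (R ^ 2),
            ((ENNReal.ofReal ‖v‖ * (C * N)) ^ 2 * volume (ball x R) ^ (1 - 2 / r.toReal)) *
              ENNReal.ofReal (t ^ (-σ)) := setLIntegral_mono' measurableSet_Ioo hbox
      _ = _ := by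
          have hmeas : Measurable fun t : ℝ => ENNReal.ofReal (t ^ (-σ)) :=
            (measurable_id.pow_const _).ennreal_ofReal
          rw [lintegral_const_mul _ hmeas, htime]
  -- the real scaling identity `(R^d)^{1-2/r} (R²)^{1-σ}/(1-σ) = R^d / (1 - σ)`
  have hreal : (R ^ d) ^ (1 - 2 / r.toReal) * ((R ^ 2) ^ (-σ + 1) / (-σ + 1)) =
      R ^ d * (1 / (1 - σ)) := by
    have h1 : (R ^ d : ℝ) ^ (1 - 2 / r.toReal) = R ^ ((d : ℝ) * (1 - 2 / r.toReal)) := by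
      rw [← Real.rpow_natCast, ← Real.rpow_mul hR.le]
    have h2 : ((R ^ 2 : ℝ)) ^ (-σ + 1) = R ^ ((2 : ℝ) * (-σ + 1)) := by
      rw [← Real.rpow_natCast R 2, ← Real.rpow_mul hR.le]
      norm_num
    have h3 : R ^ ((d : ℝ) * (1 - 2 / r.toReal)) * R ^ ((2 : ℝ) * (-σ + 1)) = R ^ d := by
      rw [← Real.rpow_add hR, ← Real.rpow_natCast R d]
      congr 1
      rw [hσ]
      field_simp
      ring
    rw [h1, h2, ← mul_div_assoc, h3, show -σ + 1 = 1 - σ by ring]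
    ring
  -- conclusion
  have hRvol : volume (ball x R) ^ (1 - 2 / r.toReal) * ENNReal.ofReal ((R ^ 2) ^ (-σ + 1) / (-σ + 1)) =
      volume (ball (0 : EuclideanSpace ℝ ι) 1) ^ (1 - 2 / r.toReal) * ENNReal.ofReal (R ^ d) *
        ENNReal.ofReal (1 / (1 - σ)) := by
    have hpos2 : 0 ≤ (R ^ 2) ^ (-σ + 1) / (-σ + 1) :=
      div_nonneg (Real.rpow_nonneg (by positivity) _) (by linarith)
    rw [hvol, ENNReal.mul_rpow_of_nonneg _ _ hexp0, ENNReal.ofReal_rpow_of_pos hRd]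
    calc ENNReal.ofReal ((R ^ d) ^ (1 - 2 / r.toReal)) * volume (ball (0 : EuclideanSpace ℝ ι) 1) ^ (1 - 2 / r.toReal) *
          ENNReal.ofReal ((R ^ 2) ^ (-σ + 1) / (-σ + 1))
        = volume (ball (0 : EuclideanSpace ℝ ι) 1) ^ (1 - 2 / r.toReal) *
            (ENNReal.ofReal ((R ^ d) ^ (1 - 2 / r.toReal)) *
              ENNReal.ofReal ((R ^ 2) ^ (-σ + 1) / (-σ + 1))) := by ring
      _ = volume (ball (0 : EuclideanSpace ℝ ι) 1) ^ (1 - 2 / r.toReal) *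
            (ENNReal.ofReal (R ^ d) * ENNReal.ofReal (1 / (1 - σ))) := by
          rw [← ENNReal.ofReal_mul (Real.rpow_nonneg hRd.le _), hreal,
            ENNReal.ofReal_mul hRd.le]
      _ = _ := by ring
  have hRd' : ENNReal.ofReal (R ^ d) ≠ 0 := (ENNReal.ofReal_pos.2 hRd).ne'
  rw [hfin]
  calc (ENNReal.ofReal (R ^ d))⁻¹ * ∫⁻ t in Ioo (0 : ℝ) (R ^ 2), ∫⁻ y in ball x R,
        ‖FunctionSpaces.BMOInv.heatExtension (fun z => ⟪u₀ z, v⟫) t y‖ₑ ^ 2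
      ≤ (ENNReal.ofReal (R ^ d))⁻¹ *
          (((ENNReal.ofReal ‖v‖ * (C * N)) ^ 2 * volume (ball x R) ^ (1 - 2 / r.toReal)) *
            ENNReal.ofReal ((R ^ 2) ^ (-σ + 1) / (-σ + 1))) := by gcongr
    _ = (ENNReal.ofReal (R ^ d))⁻¹ * ENNReal.ofReal (R ^ d) * A := by
        rw [hA, mul_assoc ((ENNReal.ofReal ‖v‖ * (C * N)) ^ 2), hRvol]
        ring
    _ = A := by rw [ENNReal.inv_mul_cancel hRd' ENNReal.ofReal_ne_top, one_mul]

/-- **`Ḃ^{-1+d/r}_{r,∞}(ℝ^d) ⊂ BMO⁻¹(ℝ^d)` for `d < r < ∞`, `2 ≤ r`** (Koch–Tataru 2001, §4 eq. (23)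
with Theorem 1): if `U ∈ Ḃ^{-1+d/r}_{r,∞}` is the tempered distribution of the field
`u₀ : ℝ^ι → ℝ^ι` (`d = card ι ≥ 1`), then every component `⟪u₀, v⟫` is in `BMO⁻¹` (divergence
form). Proof: `⟪u₀, v⟫` is locally integrable (`IsDistributionOf.locallyIntegrable`) and tempered
(`IsDistributionOf.isPolynomiallyTempered`), its Koch–Tataru Carleson quantity is finite
(`eCarlesonNorm_inner_lt_top_of_memHomBesov`), and the converse half of Koch–Tataru's Theorem 1 is
the tree's `Literature.Analysis.FunctionSpaces.memBMOInv_of_eCarlesonNorm_lt_top`.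
[cite: KochTataru2001, §4 eq. (23)] -/
theorem memBMOInvVec_of_memHomBesov_of_card_lt {r : ℝ≥0∞} [Fact (1 ≤ r)] (h2r : 2 ≤ r)
    (hdr : (Fintype.card ι : ℝ) < r.toReal) {u₀ : EuclideanSpace ℝ ι → EuclideanSpace ℝ ι}
    {U : 𝓢'(EuclideanSpace ℝ ι, EuclideanSpace ℂ ι)}
    (hU : IsDistributionOf u₀ U)
    (hB : MemHomBesov (-1 + (Fintype.card ι : ℝ) / r.toReal) r ∞ U) :
    FunctionSpaces.MemBMOInvVec u₀ := by
  intro v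
  have htemp : IsPolynomiallyTempered u₀ := hU.isPolynomiallyTempered
  have hloc : LocallyIntegrable (fun z => ⟪u₀ z, v⟫) volume := by
    refine (hU.locallyIntegrable.smul ‖v‖).mono hU.aestronglyMeasurable.inner_const
      (Eventually.of_forall fun z => ?_)
    rw [Pi.smul_apply, norm_smul, Real.norm_of_nonneg (norm_nonneg _), Real.norm_eq_abs, mul_comm]
    exact abs_real_inner_le_norm _ _
  exact FunctionSpaces.memBMOInv_of_eCarlesonNorm_lt_top hloc (htemp.inner_const v)
    (eCarlesonNorm_inner_lt_top_of_memHomBesov h2r hdr hU hB v)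

end Carleson

/-! ## The discharge on `ℝ³` -/

section Discharge

/-- **`Ḃ^{-1+3/p}_{p,∞}(ℝ³) ⊂ BMO⁻¹(ℝ³)`**, the named fact
`Literature.Analysis.FluidPDE.memBMOInv_of_memHomBesov` of `CriticalSpaces.lean` **discharged**
(Koch–Tataru, Adv. Math. 157 (2001), §4 eq. (23), `Lⁿ ⊂ B^{-1+n/p}_{p,∞} ⊂ BMO⁻¹`, with their
Theorem 1 for the divergence form): for `1 ≤ p < ∞`, a field `u₀ : ℝ³ → ℝ³` whose tempered
distribution `U` lies in `Ḃ^{-1+3/p}_{p,∞}` has all components in `BMO⁻¹`. The exponent is first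
raised to `r = max p 4` (`> 3`, `≥ 2`, finite) by the Besov embedding
`Ḃ^{-1+3/p}_{p,∞} ⊂ Ḃ^{-1+3/r}_{r,∞}` (BCD Prop. 2.20, `MemHomBesov.of_exponent_le_holds`), and then
`memBMOInvVec_of_memHomBesov_of_card_lt` applies. [cite: KochTataru2001, §4 eq. (23)] -/
theorem memBMOInv_of_memHomBesov_holds : memBMOInv_of_memHomBesov := by
  intro p _ hp u₀ U hU hB
  set r : ℝ≥0∞ := max p 4 with hr
  haveI : Fact (1 ≤ r) := ⟨le_trans Fact.out (le_max_left _ _)⟩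
  have hpr : p ≤ r := le_max_left _ _
  have h4 : (4 : ℝ≥0∞) < ∞ := ENNReal.ofNat_lt_top
  have hr_top : r ≠ ∞ := (max_lt hp h4).ne
  have h2r : 2 ≤ r := le_trans (by norm_num) (le_max_right _ _)
  have h4r : (4 : ℝ) ≤ r.toReal := by
    have := ENNReal.toReal_mono hr_top (le_max_right p 4)
    rwa [ENNReal.toReal_ofNat] at this
  have hB' := FunctionSpaces.MemHomBesov.of_exponent_le_holds (q := ∞) hpr hB
  rw [finrank_euclideanSpace_fin] at hB'
  have hidx : (-1 + 3 / p.toReal) - ((3 : ℕ) : ℝ) * (p.toReal⁻¹ - r.toReal⁻¹) =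
      -1 + (Fintype.card (Fin 3) : ℝ) / r.toReal := by
    rw [Fintype.card_fin]
    push_cast
    ring
  rw [hidx] at hB'
  refine memBMOInvVec_of_memHomBesov_of_card_lt h2r ?_ hU hB'
  rw [Fintype.card_fin]
  push_cast
  linarith

end Discharge

end Literature.Analysis.FluidPDE

end
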